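/-
Origin: expansion seat `planner-pub-hodgecm-qw8b-0`, handover 2026-08-18T03:55:41Z (`HOME/pub-hodgecm-qw8b/TorusChar.lean`, md5 55224d82, 142 lines);
landed by the gen-5 packager in gate run 20 as `HodgeCM/CM/TorusChar.lean` (verbatim).
-/
/-
Copyright: pub-hodgecm formalisation cell (harness21, 2026). New file (not vendored).
Unit pub-hodgecm-qw8b (QW8 seat 2), session planner-pub-hodgecm-qw8b-0.
-/
import Mathlib

/-!
# Characters of the torus `{z : z_i z_ī = ν}`: a monomial is a power of `ν` iff its exponents are balanced

Pure algebra (Mathlib only; no geometry, no facts).  Let `ι` be a finite set with a fixed-point-free involution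
`i ↦ ī` and `n : ι → ℕ` exponents.  On the torus `G̃ = {(z, ν) ∈ (ℂˣ)^ι × ℂˣ | z_i z_ī = ν for all i}` the
monomial character `z ↦ ∏_i z_i ^ n_i` equals `ν ^ p` identically iff

  `n_i = n_ī` for all `i`  and  `Σ_i n_i = 2p`                      (`prod_pow_eq_pow_iff_balanced`).

This is step (E3) of the dictionary behind `HodgeCM.Universe.Qw8Milne` ([QW8] Thm 2.5 (iv);
`pub-hodgecm-qw8b/QW8B-AUDIT.md` §3.2): with `ι` = the pairs `(α, r)` (simple isotypic factor, complex embedding of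
its CM field `E_α`), `ī = (α, r̄)`, Milne's group `G(A')(ℂ) = {z ∈ (Z(End⁰A') ⊗ ℂ)ˣ : z z̄ = ν}` [Milne 1999 Def 4.3 /
Thm 4.4, p.21] is this torus, and the Hodge monomial `e_S(p)` transforms by `ν^p ∏ χ_{j,s}(z)⁻¹ = ν^p (∏_i z_i^{n_i(S)})⁻¹`;
so `e_S(p)` is `G(A')`-fixed iff the exponents `n_{α,r}(S)` are balanced (the degree condition `|S| = 2p` being
automatic).  The balance itself comes from `lefChar Θ S = 0` (`AsymCoeff.lean`, `PullTypeFibres.lean`).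
-/

namespace HodgeCM

namespace TorusChar

variable {ι : Type}

/-- A fixed-point-free involution on a finite set admits a half-system `T` (`ι = T ⊔ T̄`). -/
theorem exists_halfSystem [Fintype ι] (bar : ι → ι) (hbar : Function.Involutive bar) (hfix : ∀ i, bar i ≠ i) :
    ∃ T : Finset ι, ∀ i, i ∈ T ↔ bar i ∉ T := by
  classical
  let e := Fintype.equivFin ι
  refine ⟨Finset.univ.filter (fun i => e i < e (bar i)), fun i => ?_⟩
  simp only [Finset.mem_filter, Finset.mem_univ, true_and, hbar i, not_lt]
  have hne : e i ≠ e (bar i) := fun h => hfix i (e.injective h).symm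
  exact ⟨le_of_lt, fun h => lt_of_le_of_ne h hne⟩

/-- (Ported verbatim from the HodgeCMPerL package; no docstring in the source.) -/
theorem univ_eq_union_map [Fintype ι] [DecidableEq ι] (bar : ι → ι) (hbar : Function.Involutive bar) {T : Finset ι}
    (hT : ∀ i, i ∈ T ↔ bar i ∉ T) :
    (Finset.univ : Finset ι) = T ∪ T.map ⟨bar, hbar.injective⟩ := by
  ext i
  simp only [Finset.mem_univ, Finset.mem_union, Finset.mem_map, Function.Embedding.coeFn_mk, true_iff]
  by_cases hi : i ∈ T
  · exact Or.inl hi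
  · right
    refine ⟨bar i, ?_, hbar i⟩
    rw [hT (bar i), hbar i]
    exact hi

/-- (Ported verbatim from the HodgeCMPerL package; no docstring in the source.) -/
theorem disjoint_map (bar : ι → ι) (hbar : Function.Involutive bar) {T : Finset ι}
    (hT : ∀ i, i ∈ T ↔ bar i ∉ T) : Disjoint T (T.map ⟨bar, hbar.injective⟩) := by
  rw [Finset.disjoint_left]
  intro i hi hi'
  rw [Finset.mem_map] at hi'
  obtain ⟨j, hj, hji⟩ := hi'
  simp only [Function.Embedding.coeFn_mk] at hji
  rw [hT j, hji] at hj
  exact hj hi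

/-- Over a half-system the balanced exponents sum to half the total. -/
theorem sum_halfSystem [Fintype ι] [DecidableEq ι] (bar : ι → ι) (hbar : Function.Involutive bar) {T : Finset ι}
    (hT : ∀ i, i ∈ T ↔ bar i ∉ T) (n : ι → ℕ) (hbal : ∀ i, n i = n (bar i)) :
    ∑ i, n i = 2 * ∑ i ∈ T, n i := by
  rw [univ_eq_union_map bar hbar hT, Finset.sum_union (disjoint_map bar hbar hT), Finset.sum_map]
  simp only [Function.Embedding.coeFn_mk]
  rw [Finset.sum_congr rfl (fun i _ => (hbal i).symm)]
  ring

/-- **Balanced ⟹ trivial.**  If `n_i = n_ī` and `Σ n_i = 2p` then `∏ z_i^{n_i} = ν^p` on the torus `z_i z_ī = ν`. -/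
theorem prod_pow_eq_pow_of_balanced [Fintype ι] [DecidableEq ι] (bar : ι → ι) (hbar : Function.Involutive bar) (hfix : ∀ i, bar i ≠ i)
    (n : ι → ℕ) (p : ℕ) (hbal : ∀ i, n i = n (bar i)) (hsum : ∑ i, n i = 2 * p)
    (z : ι → ℂˣ) (ν : ℂˣ) (hz : ∀ i, z i * z (bar i) = ν) : ∏ i, z i ^ n i = ν ^ p := by
  obtain ⟨T, hT⟩ := exists_halfSystem bar hbar hfix
  have hsumT : ∑ i ∈ T, n i = p := by
    have := sum_halfSystem bar hbar hT n hbal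
    omega
  rw [univ_eq_union_map bar hbar hT, Finset.prod_union (disjoint_map bar hbar hT), Finset.prod_map,
    ← Finset.prod_mul_distrib]
  simp only [Function.Embedding.coeFn_mk]
  rw [← hsumT, ← Finset.prod_pow_eq_pow_sum]
  refine Finset.prod_congr rfl (fun i _ => ?_)
  rw [← hbal i, ← mul_pow, hz i]

/-- Powers of `2 ∈ ℂˣ` are injective in the exponent. -/
theorem two_pow_injective {a b : ℕ} (h : (Units.mk0 (2 : ℂ) two_ne_zero) ^ a = (Units.mk0 (2 : ℂ) two_ne_zero) ^ b) :
    a = b := by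
  have h' : ((2 : ℂ)) ^ a = (2 : ℂ) ^ b := by
    have := congrArg Units.val h
    simpa using this
  have h'' : ((2 ^ a : ℕ) : ℂ) = ((2 ^ b : ℕ) : ℂ) := by
    push_cast
    exact h'
  exact Nat.pow_right_injective le_rfl (Nat.cast_inj.mp h'')

/-- **Trivial ⟹ balanced.**  If `∏ z_i^{n_i} = ν^p` on the whole torus, the exponents are balanced and of total
degree `2p` (test vectors: `z = (2 at i₀, 1/2 at ī₀, 1 elsewhere), ν = 1` and `z ≡ 2, ν = 4`). -/
theorem balanced_of_prod_pow_eq_pow [Fintype ι] [DecidableEq ι] (bar : ι → ι) (hbar : Function.Involutive bar) (hfix : ∀ i, bar i ≠ i)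
    (n : ι → ℕ) (p : ℕ)
    (h : ∀ (z : ι → ℂˣ) (ν : ℂˣ), (∀ i, z i * z (bar i) = ν) → ∏ i, z i ^ n i = ν ^ p) :
    (∀ i, n i = n (bar i)) ∧ ∑ i, n i = 2 * p := by
  set u : ℂˣ := Units.mk0 (2 : ℂ) two_ne_zero with hu
  constructor
  · intro i₀
    have hne : i₀ ≠ bar i₀ := fun e => hfix i₀ e.symm
    let z : ι → ℂˣ := fun j => if j = i₀ then u else if j = bar i₀ then u⁻¹ else 1
    have hz : ∀ j, z j * z (bar j) = 1 := by
      intro j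
      by_cases h1 : j = i₀
      · rw [h1]
        simp [z, hne.symm]
      · by_cases h2 : j = bar i₀
        · rw [h2, hbar i₀]
          simp [z, hne.symm]
        · have h3 : bar j ≠ i₀ := fun e => h2 (by rw [← e, hbar j])
          have h4 : bar j ≠ bar i₀ := fun e => h1 (hbar.injective e)
          simp [z, h1, h2, h3, h4]
    have hz0 : z i₀ = u := by simp [z]
    have hz1 : z (bar i₀) = u⁻¹ := by simp [z, hne.symm]
    have hprod := h z 1 hz
    rw [one_pow, Finset.prod_eq_mul i₀ (bar i₀) hne (fun j _ hj => by simp [z, hj.1, hj.2])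
        (by simp) (by simp)] at hprod
    simp only [hz0, hz1, inv_pow, mul_inv_eq_one] at hprod
    exact two_pow_injective hprod
  · have hz : ∀ j, (fun _ : ι => u) j * (fun _ : ι => u) (bar j) = u * u := fun _ => rfl
    have hprod := h (fun _ => u) (u * u) hz
    rw [Finset.prod_pow_eq_pow_sum, ← pow_two, ← pow_mul] at hprod
    exact two_pow_injective hprod

/-- **The criterion.**  On the torus `{z_i z_ī = ν}` the monomial `∏ z_i^{n_i}` is the character `ν^p` iff the
exponents are conjugation-balanced and of total degree `2p`. -/
theorem prod_pow_eq_pow_iff_balanced [Fintype ι] [DecidableEq ι] (bar : ι → ι) (hbar : Function.Involutive bar) (hfix : ∀ i, bar i ≠ i)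
    (n : ι → ℕ) (p : ℕ) :
    (∀ (z : ι → ℂˣ) (ν : ℂˣ), (∀ i, z i * z (bar i) = ν) → ∏ i, z i ^ n i = ν ^ p) ↔
      (∀ i, n i = n (bar i)) ∧ ∑ i, n i = 2 * p :=
  ⟨balanced_of_prod_pow_eq_pow bar hbar hfix n p,
    fun hb z ν hz => prod_pow_eq_pow_of_balanced bar hbar hfix n p hb.1 hb.2 z ν hz⟩

end TorusChar

end HodgeCM
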